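import Literature.Computability.QuantumComplexity.CleanComputePlaced
import Literature.Computability.QuantumComplexity.ClassicalWrapReadout
import HarnessLib

/-!
# The oracle `U_f |x⟩|y⟩ = |x⟩|y ⊕ f(x)⟩` of a polynomial-time `f` as an exact, garbage-free Clifford+`T` circuit

Topic `Literature/Computability/QuantumComplexity`. For a polynomial-time machine `M` (time exponent
`e`) the tree has Bennett's garbage-free block computing the one-hot code of the output word of `M`
behind scattered data wires (`CleanPlaced.placedOps`, `CleanComputePlaced.lean`; semantics
`CleanPlaced.clEval_placedOps`) and the decoding of that code into plain output bits
(`ClassicalWrap.listXor_outBit_trueCodes`, `ClassicalWrapReadout.lean`). This file packages the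
standard oracle of a classical function inside a quantum circuit (Nielsen–Chuang 2010, §3.2.5,
eq. (3.7): "`(x, y) → (x, y ⊕ f(x))` … the uncomputation procedure … removes the garbage"; Kitaev 1995,
§2.2 Lemma 1; Bennett 1973, §2):

* `CleanXor.ops` — `placedOps ++ xorLayer ++ placedOps.reverse`: compute the code, XOR the plain
  output bit `j < m` (the XOR of the `true`-code wires of cell `j`) onto the target wire `tpos j`,
  uncompute;
* **`CleanXor.clEval_ops_target` / `clEval_ops_of_ne`** — on a label carrying the data word `d` on the
  data wires and clean on the work window, with `M` writing `l'` on `d ++ v` in time: target `j` is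
  XORed with `[l'[j]? = some true]` (bit `j` of the output, `0` beyond the word) and EVERY other wire
  — data, work window, the rest — is unchanged;
* `CleanXor.circuit` — the exact Clifford+`T` compilation, a basis map along `clEval ops`
  (`isBasisMap_circuit`), unitary.

Everything here is proved; definitions have bodies; no named fact is introduced.

## References

* M. A. Nielsen, I. L. Chuang, *Quantum Computation and Quantum Information*, CUP 2010, §3.2.5
  (eq. (3.7), uncomputation) [NielsenChuang2010].
* A. Yu. Kitaev, arXiv:quant-ph/9511026 (1995), §2.2 Lemma 1 (`(u,0,0) ↦ (u,F(u),0)`) [Kitaev1995].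
* C. H. Bennett, IBM J. Res. Develop. 17 (1973), §2; restated and proved in the tree as
  `RevClean.clEval_cleanOps` [cite: Shor1997, §3 p.8].
-/

noncomputable section

namespace Literature.Computability.QuantumComplexity

namespace CleanXor

open Complexity Complexity.FinTM2Sim Turing Function RevSim RevClean Cryptography ClassicalWrap CleanPlaced

variable {N : ℕ}

/-! ### The program -/

section Defs

variable (hN : 0 < N) (e : ℕ) (M : TM2ComputableAux Bool Bool) (n₀ : ℕ) (v : List Bool)
  (dpos : ℕ → ℕ) (base : ℕ) (m : ℕ) (tpos : ℕ → ℕ)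

/-- The source wires of output bit `j`: the result wires (inside the work window) of the codes of
cell `j` whose symbol is the letter `true`. [folklore] -/
def srcs (j : ℕ) : List (Fin N) :=
  (trueCodes M).map fun a => finOf N hN (base + (resW e M (n₀ + v.length) j a - n₀))

/-- The target wire of output bit `j`. [folklore] -/
def tgt (j : ℕ) : Fin N := finOf N hN (tpos j)

/-- The XOR layer: output bit `j < m` onto `tgt j`. [cite: NielsenChuang2010, §3.2.5] -/
def xorOps : List (ClOp (Fin N)) :=
  xorLayer (List.range m) (srcs hN e M n₀ v base) (tgt hN tpos)

/-- **The oracle program**: compute, XOR the plain output bits onto the targets, uncompute.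
[cite: NielsenChuang2010, §3.2.5 eq. (3.7)] -/
def ops : List (ClOp (Fin N)) :=
  placedOps hN e M n₀ v dpos base ++ (xorOps hN e M n₀ v base m tpos ++ (placedOps hN e M n₀ v dpos base).reverse)

end Defs

variable {hN : 0 < N} {e : ℕ} {M : TM2ComputableAux Bool Bool} {n₀ : ℕ} {v : List Bool}
  {dpos : ℕ → ℕ} {base : ℕ} {m : ℕ} {tpos : ℕ → ℕ}

/-- **Geometry hypotheses** of the oracle: those of the placed block, plus — the targets are
pairwise distinct, below `N`, off the data wires and off the work window; at most `JJ` output bits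
are read (all cells are represented). [folklore] -/
structure GeomOK (N : ℕ) (e : ℕ) (M : TM2ComputableAux Bool Bool) (n₀ : ℕ) (v : List Bool) (dpos : ℕ → ℕ)
    (base : ℕ) (m : ℕ) (tpos : ℕ → ℕ) : Prop
    extends CleanPlaced.GeomOK N e M n₀ v dpos base where
  /-- targets injective -/
  tinj : ∀ j j', j < m → j' < m → tpos j = tpos j' → j = j'
  /-- targets below `N` -/
  tlt : ∀ j, j < m → tpos j < N
  /-- targets off the data -/
  tdata : ∀ j i, j < m → i < n₀ → tpos j ≠ dpos i
  /-- targets off the work window -/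
  twin : ∀ j, j < m → tpos j < base ∨ top e M n₀ v base ≤ tpos j
  /-- the cells read are represented -/
  mJJ : m ≤ JJ e M (n₀ + v.length)

variable (G : GeomOK N e M n₀ v dpos base m tpos)
include G

/-- The value of a target wire. [folklore] -/
theorem val_tgt {j : ℕ} (hj : j < m) : (tgt hN tpos j : ℕ) = tpos j := val_finOf_of_lt hN (G.tlt j hj)

/-- A source wire of cell `j < m` sits in the work window, at the result wire of its code. [folklore] -/
theorem srcs_window {j : ℕ} (hj : j < m) (a : OSym M) :
    n₀ ≤ resW e M (n₀ + v.length) j a ∧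
      base + (resW e M (n₀ + v.length) j a - n₀) < top e M n₀ v base := by
  have h1 := le_NN (e := e) (M := M) (n₀ + v.length)
  have h2 := NN_le_resW (e := e) (M := M) (n₀ + v.length) j a
  have h3 := resW_lt_width (e := e) (M := M) (n := n₀ + v.length) (lt_of_lt_of_le hj G.mJJ) a
  unfold top
  omega

/-- No target is a source. [folklore] -/
theorem tgt_not_mem_srcs {j j' : ℕ} (hj : j < m) (hj' : j' < m) : tgt hN tpos j' ∉ srcs hN e M n₀ v base j := by
  intro h
  unfold srcs at h
  rw [List.mem_map] at h
  obtain ⟨a, -, ha⟩ := h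
  have hw := (srcs_window G hj a).2
  have hv : (tgt hN tpos j' : ℕ) = base + (resW e M (n₀ + v.length) j a - n₀) := by
    rw [← ha, val_finOf_of_lt hN (hw.trans_le G.top_le)]
  rw [val_tgt G hj'] at hv
  rcases G.twin j' hj' with h | h <;> omega

/-- The XOR layer is well formed. [folklore] -/
theorem xorOps_wf : ∀ op ∈ xorOps hN e M n₀ v base m tpos, op.WF :=
  xorLayer_wf fun _ hj _ hj' => tgt_not_mem_srcs G (List.mem_range.1 hj) (List.mem_range.1 hj')

/-- **The oracle program is well formed.** [folklore] -/
theorem ops_wf : ∀ op ∈ ops hN e M n₀ v dpos base m tpos, op.WF := by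
  intro op hop
  unfold ops at hop
  rw [List.mem_append, List.mem_append] at hop
  rcases hop with h | h | h
  · exact placedOps_wf G.toGeomOK op h
  · exact xorOps_wf G op h
  · exact wf_reverse (placedOps_wf G.toGeomOK) op h

/-! ### Semantics -/

/-- A target wire is off the data and off the work window, as a `Fin N`. [folklore] -/
theorem tgt_off {j : ℕ} (hj : j < m) :
    (∀ i, i < n₀ → ((tgt hN tpos j : Fin N) : ℕ) ≠ dpos i) ∧
      (((tgt hN tpos j : Fin N) : ℕ) < base ∨ top e M n₀ v base ≤ ((tgt hN tpos j : Fin N) : ℕ)) := by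
  rw [val_tgt G hj]
  exact ⟨fun i hi => G.tdata j i hj hi, G.twin j hj⟩

/-- **Semantics of the oracle, target wires**: with the data word `d` on the data wires, the work
window clean and `M` writing `l'` on `d ++ v` in time, the target of bit `j < m` is XORed with
`[l'[j]? = some true]`. [cite: NielsenChuang2010, §3.2.5 eq. (3.7)] -/
theorem clEval_ops_target (d l' : List Bool) (hd : d.length = n₀)
    (hM : M.OutputsWithin (d ++ v) l' (Tn e (d.length + v.length))) (z : QReg N)
    (hzd : ∀ i (hi : i < n₀), z (finOf N hN (dpos i)) = d.getD i false)
    (hzw : ∀ w, base + w < top e M n₀ v base → z (finOf N hN (base + w)) = false) {j : ℕ} (hj : j < m) :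
    clEval (ops hN e M n₀ v dpos base m tpos) z (tgt hN tpos j) =
      (z (tgt hN tpos j) ^^ decide (l'[j]? = some true)) := by
  classical
  obtain ⟨hoff, hwin⟩ := clEval_placedOps G.toGeomOK d l' hd hM z hzd hzw
  have hdn : (d ++ v).length = n₀ + v.length := by simp [hd]
  obtain ⟨-, hgood⟩ := length_lt_JJ_of_outputsWithin (e := e) hdn (by rwa [hd] at hM)
  set z1 := clEval (placedOps hN e M n₀ v dpos base) z with hz1
  set z2 := clEval (xorOps hN e M n₀ v base m tpos) z1 with hz2
  -- the XOR layer on the target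
  have htgt1 : z1 (tgt hN tpos j) = z (tgt hN tpos j) := by
    obtain ⟨h1, h2⟩ := tgt_off G hj
    exact hoff _ h2
  have hsrc : (srcs hN e M n₀ v base j).map z1 = (trueCodes M).map fun a => outBit M l' j a := by
    unfold srcs
    rw [List.map_map]
    refine List.map_congr_left fun a _ => ?_
    obtain ⟨hn, hw⟩ := srcs_window G hj a
    simp only [Function.comp_apply]
    rw [hwin _ hw, show n₀ + (resW e M (n₀ + v.length) j a - n₀) = resW e M (n₀ + v.length) j a by omega,
      readOut_resW (lt_of_lt_of_le hj G.mJJ)]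
  have h2t : z2 (tgt hN tpos j) = (z (tgt hN tpos j) ^^ decide (l'[j]? = some true)) := by
    rw [hz2, xorOps, clEval_xorLayer_target (List.nodup_range) (fun a ha a' ha' h =>
        G.tinj a a' (List.mem_range.1 ha) (List.mem_range.1 ha') (by
          have h1 := val_tgt (hN := hN) G (List.mem_range.1 ha)
          have h2 := val_tgt (hN := hN) G (List.mem_range.1 ha')
          rw [← h1, ← h2, h]))
      (fun a ha a' ha' => tgt_not_mem_srcs G (List.mem_range.1 ha) (List.mem_range.1 ha')) z1 (List.mem_range.2 hj),
      htgt1, hsrc, listXor_outBit_trueCodes hgood]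
  -- the uncomputation does not touch the targets
  have hne : ∀ op ∈ (placedOps hN e M n₀ v dpos base).reverse, op.target ≠ tgt hN tpos j := fun op hop =>
    target_ne_of_off G.toGeomOK (tgt_off G hj).1 (tgt_off G hj).2 op (List.mem_reverse.1 hop)
  unfold ops
  rw [clEval_append, clEval_append, ← hz1, ← hz2, clEval_apply_of_forall_target_ne _ _ hne, h2t]

/-- **Semantics of the oracle, all other wires**: every wire that is not a target is unchanged —
the data are kept and the work window is clean again (for EVERY basis label: the uncomputation is
the exact inverse of the computation, and the XOR layer writes targets only).
[cite: NielsenChuang2010, §3.2.5 (uncomputation)] -/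
theorem clEval_ops_of_ne (z : QReg N) (x : Fin N) (hx : ∀ j, j < m → x ≠ tgt hN tpos j) :
    clEval (ops hN e M n₀ v dpos base m tpos) z x = z x := by
  classical
  set z1 := clEval (placedOps hN e M n₀ v dpos base) z with hz1
  set z2 := clEval (xorOps hN e M n₀ v base m tpos) z1 with hz2
  -- the XOR layer only changes targets
  have h2 : ∀ i : Fin N, (∀ j, j < m → i ≠ tgt hN tpos j) → z2 i = z1 i := fun i hi => by
    rw [hz2, xorOps]
    exact clEval_xorLayer_of_not_mem z1 fun a ha h => hi a (List.mem_range.1 ha) h.symm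
  -- frame rule for the uncomputation: targets are neither read nor written by the block
  set IsT : Fin N → Prop := fun i => ∃ j, j < m ∧ i = tgt hN tpos j with hIsT
  have hz2' : z2 = fun i => if IsT i then z2 i else z1 i := by
    funext i
    by_cases h : IsT i
    · rw [if_pos h]
    · rw [if_neg h, h2 i fun j hj hij => h ⟨j, hj, hij⟩]
  have hframe : ∀ op ∈ (placedOps hN e M n₀ v dpos base).reverse, ¬ IsT op.target ∧ ∀ c ∈ op.controls, ¬ IsT c := by
    intro op hop
    have hop' := List.mem_reverse.1 hop
    have key : ∀ i ∈ wiresOf op, ¬ IsT i := by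
      rintro i hi ⟨j, hj, rfl⟩
      rcases mem_wires_placedOps G.toGeomOK hop' hi with ⟨i₀, hi₀, hx⟩ | ⟨h1, h2⟩
      · exact (tgt_off G hj).1 i₀ hi₀ hx
      · rcases (tgt_off G hj).2 with h | h <;> omega
    exact ⟨key _ ((mem_wiresOf _ _).2 (Or.inl rfl)), fun c hc => key c ((mem_wiresOf _ _).2 (Or.inr hc))⟩
  unfold ops
  rw [clEval_append, clEval_append, ← hz1, ← hz2, hz2', clEval_ite IsT _ hframe]
  dsimp only
  rw [if_neg (fun ⟨j, hj, h⟩ => hx j hj h), hz1, clEval_reverse_placedOps (placedOps_wf G.toGeomOK)]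

/-! ### The circuit -/

/-- **The compiled oracle.** [cite: NielsenChuang2010, §3.2.5] -/
def circuit : QCircuit cliffordT N := ⟨revCompile (toRevList (ops hN e M n₀ v dpos base m tpos) (ops_wf G))⟩

/-- The compiled oracle is oracle-free (it is a word in `X`, `CNOT`, Toffoli). [folklore] -/
theorem circuit_isOracleFree : (circuit G (hN := hN)).IsOracleFree := fun g hg => revCompile_isOracleFree _ g hg

/-- **The compiled oracle is the basis map of the oracle program.** [folklore] -/
theorem isBasisMap_circuit :
    IsBasisMap ((circuit G (hN := hN)).toMatrix 0) (clEval (ops hN e M n₀ v dpos base m tpos)) := fun z => by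
  rw [circuit, revCompile_mulVec_basisState, revEval_toRevList]

/-- The compiled oracle is unitary. [folklore] -/
theorem circuit_mem_unitaryGroup : (circuit G (hN := hN)).toMatrix 0 ∈ Matrix.unitaryGroup (QReg N) ℂ :=
  QCircuit.toMatrix_mem_unitaryGroup_holds cliffordT_isUnitary_holds 0 _

end CleanXor

end Literature.Computability.QuantumComplexity
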